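import Mathlib.FieldTheory.IsAlgClosed.AlgebraicClosure
import Literature.AnabelianGeometry.AbsoluteAnabelian.FreeProfiniteSurfaceRelatorCusp
import Literature.AnabelianGeometry.AbsoluteAnabelian.FreeProSigmaNonVacuity
import Literature.AnabelianGeometry.AbsoluteAnabelian.AbsTopILem45iModelProofs
import Literature.AnabelianGeometry.AbsoluteAnabelian.AbsTopIII.CcnTransgressionFreeGeom
import Literature.AnabelianGeometry.AbsoluteAnabelian.AbsTopIII.CurveModelProp14iiReduction
import Literature.GroupTheory.ProfiniteSubquotients
import HarnessLib

/-!
# [AbsTopIII] Prop. 1.4: a GENERIC once-punctured model builder, and ALL FIVE Prop. 1.4 rows at the closed surface of genus `g`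

Mochizuki, *Topics in Absolute Anabelian Geometry III*, §1, Prop. 1.4 (i)/(ii), manuscript p. 31 (lit key
`paper:url-5493eb38cbb7`).  The five `CurveModel`-relative named facts of Prop. 1.4 — `Prop_1_4_i` (FACT-LIST
F-0339), `Prop_1_4_i'` (F-0340), `Prop_1_4_ii` (F-0341), `Prop_1_4_ii_transgression` (F-0338),
`Prop_1_4_ii_sync` (F-0365) — have refuted universal closures and hold at MODELS built from profinite
completions of topological fundamental groups: the once-punctured torus (abc-iut-f-076,
`CurveModel.exists_oncePuncturedTorus_prop_1_4`, all five, genus `1` — outside print's hyperbolicity for the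
proper curve) and the once-punctured closed surface of genus `g ≥ 2` (abc-iut-L4-t17,
`CurveModel.exists_thm_1_9_b_closedSurface`: F-0339/F-0338/F-0365 and Thm. 1.9 (b), but NOT F-0340/F-0341).
Each of those files re-types the same ~150-line two-curve model inside its `∃`-proof.  This PROOF-ONLY file
(no definitions, no named facts) factors the construction ONCE through an abstract input and closes the two
missing cells:

* `CurveModel.exists_oncePunctured_of_cuspDatum` — **generic builder.**  INPUT: a profinite group `P` and an
  element `c ∈ P` such that `I := ⟨c⟩⁻` is free procyclic, `I ∩ [N, P]⁻ = 1` for `N := ⟨⟨I⟩⟩⁻`,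
  `I ≤ [P, P]⁻`, `N ≠ P`, and `P` is free profinite of finite rank (`IsFreePro P 𝔓𝔯𝔦𝔪𝔢𝔰`).  OUTPUT: a model
  `M : CurveModel` over `k = ℚ̄` (`G_k = 1`, `Π = Δ`) with two scheme-like curves `U_x ⊆ X`, `X` proper of
  any prescribed genus label, `Π_{U_x} := P`, ONE rational cusp `x` with `D_x = I_x := I`, `Π_X := P/N`,
  `res :=` the quotient map, such that `(U_x ⊆ X, x)` is a cyclotome presentation, `Δ_X ≠ 1`, and
  **all five rows F-0339 ∧ F-0340 ∧ F-0341 ∧ F-0338 ∧ F-0365 hold at `M`** (F-0338/F-0365 by f-076's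
  instance-class theorems `prop_1_4_ii_transgression_of_isFreePro` / `prop_1_4_ii_sync_of_isFreePro`; F-0341 by
  abc-iut's reduction `prop_1_4_ii_iff_inf_eq_bot`; F-0340 with `S = {x}`: `Ker(P ↠ P/N) = N = ⟨⟨I_x⟩⟩⁻`), together
  with the carrier identification `Π_{U_x} ≃ₜ* P`.
* `CurveModel.exists_closedSurface_prop_1_4` — **the instance at the closed surface of genus `g ≥ 1`, once
  punctured** (`P = F̂_{2g} = profiniteCompletion (FreeGroup (Fin (g + g)))`, `c = c_g = ∏ᵢ [aᵢ, bᵢ]`; the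
  cusp datum is abc-iut-L4-t17's `FreeProfiniteSurfaceRelatorCusp.lean`: `⟨c_g⟩⁻ ≅ Ẑ`,
  `⟨c_g⟩⁻ ∩ [⟨⟨c_g⟩⟩⁻, F̂_{2g}]⁻ = 1` via central images in the Heisenberg groups `H(ℤ/m)`): ALL FIVE rows
  simultaneously at a carrier INSIDE print's hypotheses for `g ≥ 2` (`X` proper hyperbolic) — the cells
  F-0340 / F-0341 at genus `≥ 2` were open.

HONEST LABEL: group-theoretic models (profinite completions of topological `π₁`'s over an algebraically closed
base, so `Π = Δ`), not the étale `π₁` of a scheme (not constructed in the tree); an instance is consistency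
evidence for the typed rows, not the printed theorem.  Nothing here bears on [IUTchIII] Cor. 3.12; typed ≠ proved.
-/

noncomputable section

open CategoryTheory Topology

namespace Literature.AnabelianGeometry.AbsoluteAnabelian.AbsTopIII

open Literature.IUT.HodgeTheaters (profiniteCompletion toCompletion)

/-- Over an algebraically closed field the absolute Galois group is trivial. [folklore] -/
private theorem subsingleton_absoluteGaloisGroup_builder (k : Type) [Field k] [IsAlgClosed k] :
    Subsingleton (Field.absoluteGaloisGroup k) := by
  refine ⟨fun σ τ => AlgEquiv.ext fun x => ?_⟩
  obtain ⟨a, rfl⟩ :=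
    (IsAlgClosed.algebraMap_bijective_of_isIntegral (k := k) (K := AlgebraicClosure k)).2 x
  rw [AlgEquiv.commutes, AlgEquiv.commutes]

/-- For an extension whose Galois group is trivial, `Δ = Π`. [folklore] -/
private theorem geom_eq_top_of_subsingleton_builder (E : FundamentalExtension.{0}) [Subsingleton E.gal] :
    E.geom = ⊤ := by
  rw [eq_top_iff]
  intro x _
  rw [FundamentalExtension.mem_geom]
  exact Subsingleton.elim _ _

/-- **Generic once-punctured model builder for [AbsTopIII] Prop. 1.4.**  Let `P` be a profinite group and
`c ∈ P` with `I := ⟨c⟩⁻` free procyclic, `I ∩ [N, P]⁻ = 1` where `N := ⟨⟨I⟩⟩⁻`, `I ≤ [P, P]⁻`, `N ≠ P`, and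
`P` free profinite of finite rank.  Then there is a model `M : CurveModel` over `ℚ̄` (`G_k = 1`) with two
scheme-like curves `U_x ⊆ X`, `X` proper with genus label `n`, `Π_{U_x} ≃ₜ* P` (indeed `= P`), one rational
cusp `x` with `D_x = I_x = I`, `Π_X = P/N` and `res =` the quotient map, such that `(U_x ⊆ X, x)` IS a cyclotome
presentation, `Δ_X ≠ 1`, and the five named facts `Prop_1_4_i` (F-0339), `Prop_1_4_i'` (F-0340), `Prop_1_4_ii`
(F-0341), `Prop_1_4_ii_transgression` (F-0338), `Prop_1_4_ii_sync` (F-0365) ALL hold at `M`.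
[cite: MochizukiAbsTopIII2015, Prop 1.4 p.31] -/
theorem CurveModel.exists_oncePunctured_of_cuspDatum (P : ProfiniteGrp.{0}) (c : P)
    (hIfree : FundamentalExtension.IsFreeProcyclic (Subgroup.zpowers c).topologicalClosure)
    (hIN : (Subgroup.zpowers c).topologicalClosure ⊓
      (⁅(Subgroup.normalClosure ((Subgroup.zpowers c).topologicalClosure : Set P)).topologicalClosure,
        (⊤ : Subgroup P)⁆).topologicalClosure = ⊥)
    (hIle : (Subgroup.zpowers c).topologicalClosure ≤
      (⁅(⊤ : Subgroup P), (⊤ : Subgroup P)⁆).topologicalClosure)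
    (hNtop : (Subgroup.normalClosure
      ((Subgroup.zpowers c).topologicalClosure : Set P)).topologicalClosure ≠ ⊤)
    (hPfree : IsFreePro P {p : ℕ | p.Prime}) (n : ℕ) :
    ∃ (M : CurveModel.{0}) (Ux X : M.Curve) (h : M.IsCofiniteOpen Ux X) (x : (M.cusps Ux).Cusp),
      M.IsScheme Ux ∧ M.IsScheme X ∧ M.IsProper X ∧ M.genus X = n ∧
        (∀ y : (M.cusps Ux).Cusp, (M.cusps Ux).IsRational y) ∧
        Nonempty ((M.ext Ux).arith ≃ₜ* P) ∧
        M.IsCyclotomePresentation h x ∧ (M.ext X).geom ≠ ⊥ ∧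
        M.Prop_1_4_i ∧ M.Prop_1_4_i' ∧ M.Prop_1_4_ii ∧ M.Prop_1_4_ii_transgression ∧ M.Prop_1_4_ii_sync := by
  classical
  -- the base field `ℚ̄` and its trivial Galois group
  haveI : Subsingleton (Field.absoluteGaloisGroup (AlgebraicClosure ℚ)) :=
    subsingleton_absoluteGaloisGroup_builder _
  have hS : ∀ p : ℕ, p.Prime → p ∈ {p : ℕ | p.Prime} := fun p hp => hp
  -- the cusp: `I = ⟨c⟩⁻`, `N = ⟨⟨I⟩⟩⁻`
  let I : Subgroup P := (Subgroup.zpowers c).topologicalClosure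
  let N : Subgroup P := (Subgroup.normalClosure (I : Set P)).topologicalClosure
  have hIc : IsClosed (I : Set P) := Subgroup.isClosed_topologicalClosure _
  have hNc : IsClosed (N : Set P) := Subgroup.isClosed_topologicalClosure _
  haveI hNn : N.Normal := Subgroup.is_normal_topologicalClosure _
  -- the quotient `P / N` as a profinite group
  haveI : TotallyDisconnectedSpace (P ⧸ N) :=
    Literature.GroupTheory.ProfiniteSubquotients.totallyDisconnectedSpace_quotient N hNc
  let Q : ProfiniteGrp.{0} := ProfiniteGrp.of (P ⧸ N)
  -- the two extensions (`G = G_{ℚ̄} = 1`, augmentation trivial) and the quotient morphism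
  let G : ProfiniteGrp.{0} := absoluteGaloisGrp (AlgebraicClosure ℚ)
  let E₁ : FundamentalExtension.{0} :=
    { arith := P, gal := G, aug := 1, aug_surjective := fun _ => ⟨1, Subsingleton.elim _ _⟩ }
  let E₀ : FundamentalExtension.{0} :=
    { arith := Q, gal := G, aug := 1, aug_surjective := fun _ => ⟨1, Subsingleton.elim _ _⟩ }
  let π : P →ₜ* (P ⧸ N) :=
    { QuotientGroup.mk' N with continuous_toFun := QuotientGroup.continuous_mk }
  let q : E₁ ⟶ E₀ := ⟨π, ContinuousMonoidHom.id _, fun _ => Subsingleton.elim _ _⟩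
  have hE₁ : E₁.geom = ⊤ := geom_eq_top_of_subsingleton_builder E₁
  have hE₀ : E₀.geom = ⊤ := geom_eq_top_of_subsingleton_builder E₀
  -- cusps: one cusp of `U_x` with `D = I`; none on `X`
  let C₁ : E₁.CuspidalData :=
    { Cusp := PUnit
      Dcusp := fun _ => I
      Icusp := fun _ => I ⊓ E₁.geom
      Icusp_eq := fun _ => rfl
      isClosed_Dcusp := fun _ => hIc
      eq_of_conj := fun x y _ _ => Subsingleton.elim x y }
  let C₀ : E₀.CuspidalData :=
    { Cusp := PEmpty
      Dcusp := fun x => x.elim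
      Icusp := fun x => x.elim
      Icusp_eq := fun x => x.elim
      isClosed_Dcusp := fun x => x.elim
      eq_of_conj := fun x => x.elim }
  have hC₁ : ∀ x, C₁.Icusp x = I := fun x => by
    change I ⊓ E₁.geom = I
    rw [hE₁, inf_top_eq]
  have hrat : ∀ y, C₁.IsRational y := fun _ g _ => ⟨1, I.one_mem, Subsingleton.elim _ _⟩
  -- the model: `Curve = {X, U_x}` (`false ↦ X`, `true ↦ U_x`)
  let M : CurveModel.{0} :=
    { Curve := ULift.{1} Bool
      base := fun _ => AlgebraicClosure ℚ
      ext := fun U => cond U.down E₁ E₀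
      galIso := fun U => by
        rcases U with ⟨_ | _⟩ <;> exact Iso.refl _
      cusps := fun U => by
        rcases U with ⟨_ | _⟩
        exacts [C₀, C₁]
      IsProper := fun U => U = ⟨false⟩
      IsScheme := fun _ => True
      genus := fun _ => n
      FunctionField := fun _ => AlgebraicClosure ℚ
      Point := fun _ => PEmpty
      decomp := fun _ x => x.elim
      IsNFCurve := fun _ => True
      IsNFPoint := fun _ x => x.elim
      IsNFRational := fun _ _ => True
      IsNFConstant := fun _ _ => True
      NFFunctionField := fun _ => AlgebraicClosure ℚ
      IsStrictlyBelyiType := fun _ => False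
      IsCofiniteOpen := fun U U' => U = ⟨true⟩ ∧ U' = ⟨false⟩
      res := fun {U U'} h => by
        obtain ⟨rfl, rfl⟩ := h
        exact q }
  -- the presentation `(U_x ⊆ X, x)`
  have hker1 : cuspidalKernel q = (Subgroup.normalClosure (C₁.Icusp PUnit.unit : Set P)).topologicalClosure := by
    rw [hC₁]
    change q.arith.toMonoidHom.ker ⊓ E₁.geom = N
    rw [hE₁, inf_top_eq]
    exact QuotientGroup.ker_mk' N
  have hpres : M.IsCyclotomePresentation (Ux := ⟨true⟩) (X := ⟨false⟩) ⟨rfl, rfl⟩ PUnit.unit := by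
    refine
      { isScheme := ⟨trivial, trivial⟩
        isProper := rfl
        isRational := hrat PUnit.unit
        isFreeProcyclic := by
          change FundamentalExtension.IsFreeProcyclic (C₁.Icusp PUnit.unit)
          rw [hC₁]
          exact hIfree
        kernel_eq := hker1
        isCuspidallyCentral := ?_ }
    change IsCuspidallyCentralExtension q (C₁.Icusp PUnit.unit)
    rw [isCuspidallyCentralExtension_iff_inf_eq_bot q C₁ PUnit.unit (hrat PUnit.unit) hker1]
    unfold cuspidallyCentralModulus
    rw [hker1, hC₁, hE₁]
    exact hIN
  -- the structural inputs of f-076's instance-class theorems, at every presentation of `M`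
  have hq : ∀ (Ux X : M.Curve) (h : M.IsCofiniteOpen Ux X) (x : (M.cusps Ux).Cusp),
      M.IsCyclotomePresentation h x →
        Set.SurjOn (M.res h).arith (M.ext Ux).geom (M.ext X).geom := by
    intro Ux X h x _
    obtain ⟨rfl, rfl⟩ := h
    change Set.SurjOn π E₁.geom E₀.geom
    rw [hE₁, hE₀]
    rintro y -
    obtain ⟨g, rfl⟩ := QuotientGroup.mk_surjective y
    exact ⟨g, Subgroup.mem_top g, rfl⟩
  have hI : ∀ (Ux X : M.Curve) (h : M.IsCofiniteOpen Ux X) (x : (M.cusps Ux).Cusp),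
      M.IsCyclotomePresentation h x →
        (M.cusps Ux).Icusp x ≤ (⁅(M.ext Ux).geom, (M.ext Ux).geom⁆).topologicalClosure := by
    intro Ux X h x _
    obtain ⟨rfl, rfl⟩ := h
    change C₁.Icusp x ≤ (⁅E₁.geom, E₁.geom⁆).topologicalClosure
    rw [hC₁, hE₁]
    exact hIle
  have hfree : ∀ (Ux X : M.Curve) (h : M.IsCofiniteOpen Ux X) (x : (M.cusps Ux).Cusp),
      M.IsCyclotomePresentation h x → IsFreePro (M.ext Ux).geom {p : ℕ | p.Prime} := by
    intro Ux X h x _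
    obtain ⟨rfl, rfl⟩ := h
    change IsFreePro E₁.geom {p : ℕ | p.Prime}
    rw [hE₁]
    let e : P ≃ₜ* (⊤ : Subgroup P) :=
      { Subgroup.topEquiv.symm with
        continuous_toFun := Continuous.subtype_mk continuous_id _
        continuous_invFun := continuous_subtype_val }
    obtain ⟨k, gens, hP⟩ := hPfree
    exact ⟨k, _, hP.of_continuousMulEquiv e⟩
  -- F-0339: every cuspidal inertia group is free procyclic (the one cusp of `U_x`; `X` has none)
  have h14i : M.Prop_1_4_i := by
    rintro ⟨_ | _⟩ _ x
    · exact x.elim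
    · change FundamentalExtension.IsFreeProcyclic (C₁.Icusp x)
      rw [hC₁]
      exact hIfree
  -- F-0340: `res` is surjective with bijective Galois part and kernel `⟨⟨I_x⟩⟩⁻` (`S = {x}`)
  have h14i' : M.Prop_1_4_i' := by
    intro U U' h _ _
    obtain ⟨rfl, rfl⟩ := h
    change Function.Surjective π ∧ Function.Bijective (ContinuousMonoidHom.id G) ∧
      ∃ S : Set C₁.Cusp, π.toMonoidHom.ker =
        (Subgroup.normalClosure (⋃ c ∈ S, (C₁.Icusp c : Set P))).topologicalClosure
    refine ⟨QuotientGroup.mk'_surjective N, Function.bijective_id, Set.univ, ?_⟩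
    have hU : (⋃ c ∈ (Set.univ : Set C₁.Cusp), (C₁.Icusp c : Set P)) = (I : Set P) := by
      ext g
      simp only [Set.mem_iUnion, Set.mem_univ, hC₁, SetLike.mem_coe, exists_const]
    rw [hU]
    exact QuotientGroup.ker_mk' N
  -- F-0341: `1 → I_x → Δ^{c-cn}_{U_x} → Δ_X → 1`, via the reduction to the injectivity clause
  have h14ii : M.Prop_1_4_ii := by
    rw [CurveModel.prop_1_4_ii_iff_inf_eq_bot]
    intro Ux X h _ _ _ x hx hker
    obtain ⟨rfl, rfl⟩ := h
    change C₁.Icusp x ⊓ cuspidallyCentralModulus q = ⊥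
    change cuspidalKernel q = (Subgroup.normalClosure (C₁.Icusp x : Set P)).topologicalClosure at hker
    unfold cuspidallyCentralModulus
    rw [hker, hC₁, hE₁]
    exact hIN
  refine ⟨M, ⟨true⟩, ⟨false⟩, ⟨rfl, rfl⟩, PUnit.unit, trivial, trivial, rfl, rfl, hrat,
    ⟨ContinuousMulEquiv.refl _⟩, hpres, ?_, h14i, h14i', h14ii,
    M.prop_1_4_ii_transgression_of_isFreePro hS hq hI hfree,
    M.prop_1_4_ii_sync_of_isFreePro hS hq hI hfree⟩
  -- `Δ_X = P / N ≠ 1` since `N ≠ P`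
  change E₀.geom ≠ ⊥
  rw [hE₀]
  intro htop
  apply hNtop
  rw [eq_top_iff]
  intro g _
  have hg : (QuotientGroup.mk g : P ⧸ N) = 1 :=
    (Subgroup.eq_bot_iff_forall _).mp htop _ (Subgroup.mem_top _)
  exact (QuotientGroup.eq_one_iff g).mp hg

/-- **All five rows of [AbsTopIII] Prop. 1.4 at the closed surface of genus `g ≥ 1`, once punctured.**  There
is a model `M : CurveModel` over `ℚ̄` with `Π_{U_x} ≃ₜ* F̂_{2g}` (`= profiniteCompletion (FreeGroup (Fin (g + g)))`,
letters `aᵢ = castAdd g i`, `bᵢ = natAdd g i`), one rational cusp `x` with `I_x = D_x = ⟨c_g⟩⁻`,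
`c_g = ∏ᵢ [aᵢ, bᵢ]`, `Π_X = F̂_{2g}/⟨⟨c_g⟩⟩⁻` (the profinite surface group), `X` proper of genus label `g`,
at which `(U_x ⊆ X, x)` is a cyclotome presentation, `Δ_X ≠ 1`, and `Prop_1_4_i` (F-0339) ∧ `Prop_1_4_i'`
(F-0340) ∧ `Prop_1_4_ii` (F-0341) ∧ `Prop_1_4_ii_transgression` (F-0338) ∧ `Prop_1_4_ii_sync` (F-0365) hold
SIMULTANEOUSLY — for `g ≥ 2` a carrier inside print's hypotheses (`X` proper hyperbolic).  Cusp datum: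
abc-iut-L4-t17's `IsFreeProOn.isFreeProcyclic_topologicalClosure_zpowers_surfaceRelator`,
`IsFreeProOn.topologicalClosure_zpowers_surfaceRelator_inf_eq_bot`, `topologicalClosure_zpowers_surfaceRelator_le`;
`⟨⟨c_g⟩⟩⁻ ≠ F̂_{2g}` by the character `a₀ ↦ 1 ∈ ℤ/2`.  HONEST LABEL: a group-theoretic model (profinite
completion of the topological `π₁`), not the étale `π₁`. [cite: MochizukiAbsTopIII2015, Prop 1.4 p.31] -/
theorem CurveModel.exists_closedSurface_prop_1_4 (g : ℕ) (hg : 1 ≤ g) :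
    ∃ (M : CurveModel.{0}) (Ux X : M.Curve) (h : M.IsCofiniteOpen Ux X) (x : (M.cusps Ux).Cusp),
      M.IsScheme Ux ∧ M.IsScheme X ∧ M.IsProper X ∧ M.genus X = g ∧
        (∀ y : (M.cusps Ux).Cusp, (M.cusps Ux).IsRational y) ∧
        Nonempty ((M.ext Ux).arith ≃ₜ* profiniteCompletion (FreeGroup (Fin (g + g)))) ∧
        M.IsCyclotomePresentation h x ∧ (M.ext X).geom ≠ ⊥ ∧
        M.Prop_1_4_i ∧ M.Prop_1_4_i' ∧ M.Prop_1_4_ii ∧ M.Prop_1_4_ii_transgression ∧ M.Prop_1_4_ii_sync := by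
  classical
  have hg0 : 0 < g := hg
  let P : ProfiniteGrp.{0} := profiniteCompletion (FreeGroup (Fin (g + g)))
  let gens : Fin (g + g) → P := fun i => toCompletion (FreeGroup (Fin (g + g))) (FreeGroup.of i)
  have hP : IsFreeProOn P {p : ℕ | p.Prime} gens := isFreeProOn_profiniteCompletion_freeGroup (g + g)
  have hS : ∀ p : ℕ, p.Prime → p ∈ {p : ℕ | p.Prime} := fun p hp => hp
  -- the surface relator `c_g = ∏ [a_i, b_i]`
  let c : P := ((List.finRange g).map fun i => gens (Fin.castAdd g i) * gens (Fin.natAdd g i) *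
    (gens (Fin.castAdd g i))⁻¹ * (gens (Fin.natAdd g i))⁻¹).prod
  have hIfree : FundamentalExtension.IsFreeProcyclic (Subgroup.zpowers c).topologicalClosure :=
    hP.isFreeProcyclic_topologicalClosure_zpowers_surfaceRelator hS hg0
  have hIle : (Subgroup.zpowers c).topologicalClosure ≤
      (⁅(⊤ : Subgroup P), (⊤ : Subgroup P)⁆).topologicalClosure :=
    topologicalClosure_zpowers_surfaceRelator_le _ _
  have hIN : (Subgroup.zpowers c).topologicalClosure ⊓
      (⁅(Subgroup.normalClosure ((Subgroup.zpowers c).topologicalClosure : Set P)).topologicalClosure,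
        (⊤ : Subgroup P)⁆).topologicalClosure = ⊥ :=
    hP.topologicalClosure_zpowers_surfaceRelator_inf_eq_bot hS hg0
  -- `⟨⟨c_g⟩⟩⁻ ≠ F̂_{2g}`: the continuous character `a₀ ↦ 1 ∈ ℤ/2` kills `[P, P]⁻ ⊇ ⟨⟨c_g⟩⟩⁻` but not `a₀`
  have hNtop : (Subgroup.normalClosure
      ((Subgroup.zpowers c).topologicalClosure : Set P)).topologicalClosure ≠ ⊤ := by
    intro htop
    have h01 : Fin.castAdd g (⟨0, hg0⟩ : Fin g) ≠ Fin.natAdd g ⟨0, hg0⟩ := by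
      intro h
      have := congrArg Fin.val h
      simp at this
      omega
    letI : TopologicalSpace (Multiplicative (ZMod 2)) := ⊥
    haveI : DiscreteTopology (Multiplicative (ZMod 2)) := ⟨rfl⟩
    obtain ⟨χ, hχc, hχa, -⟩ := hP.exists_continuous_hom_pair hS h01 (Multiplicative (ZMod 2))
      (Multiplicative.ofAdd 1) 1
    have hcl : IsClosed (χ.ker : Set P) := by
      rw [MonoidHom.coe_ker]
      exact (isClosed_discrete _).preimage hχc
    have hcomm : (⁅(⊤ : Subgroup P), (⊤ : Subgroup P)⁆).topologicalClosure ≤ χ.ker := by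
      refine Subgroup.topologicalClosure_minimal _ ?_ hcl
      rw [← commutator_def]
      exact Abelianization.commutator_subset_ker χ
    have hχN : (Subgroup.normalClosure
        ((Subgroup.zpowers c).topologicalClosure : Set P)).topologicalClosure ≤ χ.ker :=
      Subgroup.topologicalClosure_minimal _ (Subgroup.normalClosure_le_normal (hIle.trans hcomm)) hcl
    have ha : gens (Fin.castAdd g ⟨0, hg0⟩) ∈ χ.ker := hχN (by rw [htop]; exact Subgroup.mem_top _)
    rw [MonoidHom.mem_ker, hχa] at ha
    exact absurd ha (by decide)
  exact CurveModel.exists_oncePunctured_of_cuspDatum P c hIfree hIN hIle hNtop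
    (isFreePro_profiniteCompletion_freeGroup (g + g)) g

end Literature.AnabelianGeometry.AbsoluteAnabelian.AbsTopIII
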